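import Literature.AnabelianGeometry.EtaleTheta.Discharge.Sec3Cor38Transport
import Literature.AnabelianGeometry.EtaleTheta.Discharge.Sec3Cor38CriterionSlice
import Literature.AlgebraicGeometry.Frobenioids.PerfectionSquareUnique
import Literature.AlgebraicGeometry.Frobenioids.PerfectionFunctorialityComp
import Literature.AlgebraicGeometry.Frobenioids.PerfectionEndomorphisms
import Literature.AlgebraicGeometry.Frobenioids.PerfectionPreSteps
import HarnessLib

/-!
# [EtTh] Corollary 3.8 (i)/(ii) sub-DAG — row C38-L06: the four `Ψ^pf`-level inputs ("[FrdI] Thm. 3.4 (ii)/(iv)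
# for `Ψ^pf`") are THEOREMS for `Ψ^pf := Perfection.map`, and C38-L06 ⟸ C38-L02a, L04, L05

Mochizuki, *The étale theta function …*, Publ. RIMS **45** (2009), Cor. 3.8, proof PDF p.81 l.20–28
[cite: MochizukiEtTh2009, Cor 3.8 p.81]: the criterion for base-field-theoretic pre-steps is stated in `C_i^pf` and
transported along `Ψ` ("Thus, `Ψ` preserves the base-field-theoretic pre-steps"); what the transport uses is that
`Ψ^pf` ([FrdI] Thm. 3.4 (iii)) and its quasi-inverse preserve (co-angular) pre-steps and the submonoids `O^▷(−)`
OF THE PERFECTIONS — Mochizuki, *The geometry of Frobenioids I*, Kyushu J. Math. **62** (2008), Thm. 3.4 (ii)/(iv)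
pp.62–63 applied to `Ψ^pf` (`C_i^pf` are again tempered Frobenioids, [EtTh] Rmk. 3.6.4)
[cite: MochizukiFrdI2008, Thm. 3.4 (iii) p.62].

abc-iut cell, layer L2, seat abc-iut-w5-d124 (gen 3); proof-only companion of the FROZEN
`TemperedFrobenioidCor38Sub.lean` (p414329; row C38-L06 derivation `Cor38Hyp.PreservesBsFldPreStepsOfCriterion`,
PROVED by `Sec3Cor38Transport.lean` p416298 with the four `Ψ^pf`-level transports as explicit binders).  Here those
binders are DISCHARGED for THE perfections `C_i^pf = PreFrobenioidData.perfection hF_i` and the functor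
`Ψ^pf = PreFrobenioid.Perfection.map hΨ` of seat abc-iut-L1-d1 (`Ψ` compatible with arrows of Frobenius type), by
the representative-level dictionary of abc-iut-L1-d9's `C^pf` (`isPreStep_mk_iff`, `endClassHom_mem_iff`):

* `PerfectionMap.isPreStep_map` — `Ψ^pf` carries pre-steps of `C₁^pf` to pre-steps of `C₂^pf` as soon as `Ψ`
  carries pre-steps to pre-steps (`Ψ^pf[θ] = [j⁻¹ ≫ Ψθ ≫ j′]` with `j, j′` isomorphisms);
  `PerfectionMap.map_mem_endSubmonoid` — `Ψ^pf` carries `O^▷((A, n))` into `O^▷((ΨA, n))` as soon as `Ψ`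
  carries `O^▷(−)` into `O^▷(−)` (`O^▷((A, n)) = lim_→ O^▷(A^{(c)})`); both for ARBITRARY Frobenioids;
* for tempered Frobenioids (`Cor38Hyp`): co-angular pre-steps (every arrow of the perfection of a Frobenioid of
  Frobenius-isotropic type is co-angular, Thm. 3.7 (i)), for `Ψ^pf` and for `(Ψ⁻¹)^pf`, from row C38-L02a;
  `O^▷` for both, from row C38-L04;
* `Cor38Hyp.exists_perfectionEquiv` — an equivalence `Ψ^pf : C₁^pf ≌ C₂^pf` with `functor = (Ψ)^pf` and
  `inverse = (Ψ⁻¹)^pf` ON THE NOSE (unit/counit from the structure-compatible `1`-uniqueness of [FrdI] Thm. 3.4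
  (iii), abc-iut-L1-d1 `map_unique_of_isFrobeniusCompatible`, applied to `Ψ ⋙ Ψ⁻¹ ≅ 𝟭` and
  `(Ψ ⋙ Ψ⁻¹)^pf = Ψ^pf ⋙ (Ψ⁻¹)^pf`, abc-iut-L6-t6 `map_comp_eq'`), `1`-commuting with `C_i → C_i^pf`;
* **`Cor38Hyp.preservesBsFldPreSteps_of_C_rows`: C38-L06 ⟸ C38-L02a + C38-L04 + C38-L05(C₁) + C38-L05(C₂)**
  (modulo `hF₁`, `hF₂` and a Frobenius-compatibility witness of `Ψ`, `Ψ⁻¹` — itself a consequence of C38-L02a at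
  the canonical vocabulary, `Sec3Cor38PerfectionR.lean`) — NO `Ψ^pf`-level hypothesis remains.

No definitions (the equivalence is assembled inside the proof of an existence statement); no statement of either
paper is restated or strengthened.
HONEST FRAMING: refereed pre-IUT material; nothing here bears on [IUTchIII] Cor. 3.12; C38-L05 itself stays with
its named binders (seats abc-iut-w4-d008 / w4-d084).
-/

namespace Literature.AnabelianGeometry.EtaleTheta

open CategoryTheory Opposite Literature.AlgebraicGeometry.Frobenioids

/-! ## `Ψ^pf = Perfection.map` inherits pre-step and `O^▷` preservation from `Ψ` (any Frobenioids) -/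

namespace PerfectionMap

open PreFrobenioid PreFrobenioid.Perfection

universe w₁ v₁ v₁' u₁ u₁' w₂ v₂ v₂' u₂ u₂'

variable {D₁ : Type u₁} [Category.{v₁} D₁] {Φ₁ : D₁ᵒᵖ ⥤ CommMonCat.{w₁}}
  {C₁ : Type u₁'} [Category.{v₁'} C₁] {F₁ : C₁ ⥤ ElemFrobenioid Φ₁} {hF₁ : IsFrobenioid F₁}
  {D₂ : Type u₂} [Category.{v₂} D₂] {Φ₂ : D₂ᵒᵖ ⥤ CommMonCat.{w₂}}
  {C₂ : Type u₂'} [Category.{v₂'} C₂] {F₂ : C₂ ⥤ ElemFrobenioid Φ₂} {hF₂ : IsFrobenioid F₂}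
  {G : C₁ ⥤ C₂} (hG : IsFrobeniusCompatible F₁ F₂ G)

/-- Pre-steps are stable under conjugation by isomorphisms (isomorphisms are pre-steps, pre-steps compose;
[FrdI] Rmk. 1.1.1). [cite: MochizukiFrdI2008, Def. 1.2 (iii) p.22] -/
theorem isPreStep_conj {A A' B B' : C₂} (e : A' ≅ A) (e' : B ≅ B') {φ : A ⟶ B} (hφ : IsPreStep F₂ φ) :
    IsPreStep F₂ (e.hom ≫ φ ≫ e'.hom) :=
  IsPreStep.comp F₂ (isPreStep_of_isIso F₂ e.hom) (IsPreStep.comp F₂ hφ (isPreStep_of_isIso F₂ e'.hom))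

/-- `O^▷(−)` is stable under conjugation by an isomorphism: `Base(j⁻¹ θ j) = Base(j)⁻¹ Base(j) = id`,
`deg_Fr(j⁻¹ θ j) = 1` ([FrdI] Rmk. 1.1.1). [cite: MochizukiFrdI2008, Def. 1.2 (ii) p.22] -/
theorem conj_mem_endSubmonoid {A B : C₂} (j : A ≅ B) {θ : A ⟶ A} (hθ : (θ : End A) ∈ endSubmonoid F₂ A) :
    (j.inv ≫ θ ≫ j.hom : End B) ∈ endSubmonoid F₂ B := by
  refine ⟨?_, IsLinear.comp F₂ (isLinear_of_isIso F₂ j.inv)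
    (IsLinear.comp F₂ hθ.2 (isLinear_of_isIso F₂ j.hom))⟩
  change Base F₂ (j.inv ≫ θ ≫ j.hom) = 𝟙 _
  rw [base_comp, base_comp, show Base F₂ θ = 𝟙 _ from hθ.1, Category.id_comp, ← base_comp, j.inv_hom_id,
    base_id]

include hG in
/-- **`Ψ^pf` carries pre-steps of `C₁^pf` to pre-steps of `C₂^pf`** as soon as `Ψ` carries pre-steps of `C₁` to
pre-steps of `C₂`: on a representative, `Ψ^pf[θ] = [j_A⁻¹ ≫ Ψθ ≫ j_B]`, and `[r]` is a pre-step iff `r` is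
(abc-iut-L1-d9 `isPreStep_mk_iff`). [cite: MochizukiFrdI2008, Thm. 3.4 (iii) p.62] -/
theorem isPreStep_map
    (hpre : ∀ ⦃A B : C₁⦄ (φ : A ⟶ B), IsPreStep F₁ φ → IsPreStep F₂ (G.map φ))
    {X Y : Perfection hF₁} {f : X ⟶ Y} (hf : (ops hF₁).IsPreStep f) :
    (ops hF₂).IsPreStep ((map (hF₁ := hF₁) (hF₂ := hF₂) hG).map f) := by
  obtain ⟨r, rfl⟩ := Hom.mk_surjective f
  exact (isPreStep_mk_iff (hF := hF₂) (X := objMap G X) (Y := objMap G Y) (repMap hG r)).2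
    (isPreStep_conj (frobPowIso hG X.obj r.L.a).symm (frobPowIso hG Y.obj r.L.b)
      (hpre _ ((isPreStep_mk_iff r).1 hf)))

include hG in
/-- `Ψ^pf` on the class of an endomorphism of `A^{(c)}`: `Ψ^pf [θ]_{(c,c)} = [j⁻¹ ≫ Ψθ ≫ j]_{(c,c)}`.
[cite: MochizukiFrdI2008, Thm. 3.4 (iii) p.62] -/
theorem map_endClass (X : Perfection hF₁) (c : ℕ+) (θ : frobPow hF₁ X.obj c ⟶ frobPow hF₁ X.obj c) :
    (map (hF₁ := hF₁) (hF₂ := hF₂) hG).map (endClass X c θ) =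
      endClass ((map (hF₁ := hF₁) (hF₂ := hF₂) hG).obj X) c
        ((frobPowIso hG X.obj c).inv ≫ G.map θ ≫ (frobPowIso hG X.obj c).hom) :=
  rfl

include hG in
/-- **`Ψ^pf` carries `O^▷((A, n))` into `O^▷((ΨA, n))`** as soon as `Ψ` carries each `O^▷(A′)` into
`O^▷(ΨA′)`: `O^▷((A, n)) = lim_→ O^▷(A^{(c)})` (abc-iut-L1-d9 `endClassHom_mem_iff`), `Ψ^pf` acts on a class through
`Ψ` and conjugation by the comparison isomorphism `Ψ(A^{(c)}) ≅ (ΨA)^{(c)}`.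
[cite: MochizukiFrdI2008, Thm. 3.4 (iv) p.63] -/
theorem map_mem_endSubmonoid
    (hO : ∀ (A : C₁) (α : End A), α ∈ endSubmonoid F₁ A → (G.map α : End (G.obj A)) ∈ endSubmonoid F₂ (G.obj A))
    {X : Perfection hF₁} {ε : End X} (hε : ε ∈ (ops hF₁).endSubmonoid X) :
    ((map (hF₁ := hF₁) (hF₂ := hF₂) hG).map ε : End ((map (hF₁ := hF₁) (hF₂ := hF₂) hG).obj X)) ∈
      (ops hF₂).endSubmonoid ((map (hF₁ := hF₁) (hF₂ := hF₂) hG).obj X) := by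
  obtain ⟨c, θ, hθ, rfl⟩ := exists_endClassHom_eq_of_mem X hε
  rw [endClassHom_apply]
  change (map hG).map (endClass X c (End.asHom θ)) ∈ _
  rw [map_endClass hG X c]
  exact (endClassHom_mem_iff ((map hG).obj X) c
    (End.of ((frobPowIso hG X.obj c).inv ≫ G.map (End.asHom θ) ≫ (frobPowIso hG X.obj c).hom))).2
    (conj_mem_endSubmonoid (frobPowIso hG X.obj c) (hO _ θ hθ))

end PerfectionMap

/-! ## For tempered Frobenioids: the C38-L06 binders as theorems, and C38-L06 from the `C`-level rows -/

universe u₀ v₀ u v w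

section Rows

variable {D₀ : Type u₀} [Category.{v₀} D₀] {V : FrdIMonoidStub.{w}} {T : RealifiedDivisorMonoids (D₀ := D₀) V}
  {D : Type u} [Category.{v} D] {VD : FrdICatStub.{u, v, w} D}
  {D₀' : Type u₀} [Category.{v₀} D₀'] {T' : RealifiedDivisorMonoids (D₀ := D₀') V}
  {D' : Type u} [Category.{v} D'] {VD' : FrdICatStub.{u, v, w} D'}
  {C₁ : TemperedFrobenioid T D VD} {C₂ : TemperedFrobenioid T' D' VD'} (h : Cor38Hyp C₁ C₂)

namespace Cor38Hyp

open TemperedFrobenioid PreFrobenioid.Perfection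

variable {hF₁ : PreFrobenioid.IsFrobenioid C₁.toElem} {hF₂ : PreFrobenioid.IsFrobenioid C₂.toElem}

/-- "[FrdI] Thm. 3.4 (ii) for `Ψ^pf`", co-angular pre-steps, FORWARD: `Ψ^pf = Perfection.map hΨ` carries
co-angular pre-steps of `C₁^pf` to co-angular pre-steps of `C₂^pf` — from C38-L02a (`Ψ` preserves pre-steps) and
Thm. 3.7 (i) (every arrow of `C₂^pf` is co-angular, `C₂` being of Frobenius-isotropic type). PROVED.
[cite: MochizukiEtTh2009, Cor 3.8 p.81] -/
theorem isCoAngularPreStep_perfectionMap (hΨ : PreFrobenioid.IsFrobeniusCompatible C₁.toElem C₂.toElem h.Ψ.functor)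
    (hps : h.PreservesPreSteps) :
    PreFrobenioidData.PreservesMor (map (hF₁ := hF₁) (hF₂ := hF₂) hΨ)
      (PreFrobenioidData.perfection hF₁).ops.IsCoAngularPreStep
      (PreFrobenioidData.perfection hF₂).ops.IsCoAngularPreStep := fun _ _ _ hf =>
  ⟨isCoAngular_of_frobeniusIsotropic (hF := hF₂) (C₂.isOfType_isFrobeniusIsotropic hF₂) _,
    PerfectionMap.isPreStep_map hΨ (fun _ _ φ hφ => (PreFrobenioidData.ofFunctor_isPreStep C₂.toElem _).1
      (hps.1 φ ((PreFrobenioidData.ofFunctor_isPreStep C₁.toElem φ).2 hφ))) hf.2⟩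

/-- "[FrdI] Thm. 3.4 (ii) for `(Ψ⁻¹)^pf`", co-angular pre-steps, BACKWARD. PROVED. [cite: MochizukiEtTh2009, Cor 3.8 p.81] -/
theorem isCoAngularPreStep_perfectionMap_inverse
    (hΨ' : PreFrobenioid.IsFrobeniusCompatible C₂.toElem C₁.toElem h.Ψ.inverse) (hps : h.PreservesPreSteps) :
    PreFrobenioidData.PreservesMor (map (hF₁ := hF₂) (hF₂ := hF₁) hΨ')
      (PreFrobenioidData.perfection hF₂).ops.IsCoAngularPreStep
      (PreFrobenioidData.perfection hF₁).ops.IsCoAngularPreStep := fun _ _ _ hf =>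
  ⟨isCoAngular_of_frobeniusIsotropic (hF := hF₁) (C₁.isOfType_isFrobeniusIsotropic hF₁) _,
    PerfectionMap.isPreStep_map hΨ' (fun _ _ φ hφ => (PreFrobenioidData.ofFunctor_isPreStep C₁.toElem _).1
      (hps.2 φ ((PreFrobenioidData.ofFunctor_isPreStep C₂.toElem φ).2 hφ))) hf.2⟩

/-- "[FrdI] Thm. 3.4 (iv) for `Ψ^pf`", `O^▷(−)`, FORWARD — from C38-L04 (`Ψ` preserves `O^▷(−)`). PROVED.
[cite: MochizukiEtTh2009, Cor 3.8 p.81] -/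
theorem map_mem_endSubmonoid_perfectionMap
    (hΨ : PreFrobenioid.IsFrobeniusCompatible C₁.toElem C₂.toElem h.Ψ.functor) (hO : h.PreservesOTri)
    (X : (PreFrobenioidData.perfection hF₁).Pf) (ε : End X)
    (hε : ε ∈ (PreFrobenioidData.perfection hF₁).ops.endSubmonoid X) :
    ((map (hF₁ := hF₁) (hF₂ := hF₂) hΨ).map ε : End ((map (hF₁ := hF₁) (hF₂ := hF₂) hΨ).obj X)) ∈
      (PreFrobenioidData.perfection hF₂).ops.endSubmonoid ((map (hF₁ := hF₁) (hF₂ := hF₂) hΨ).obj X) :=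
  PerfectionMap.map_mem_endSubmonoid hΨ hO.1 hε

/-- "[FrdI] Thm. 3.4 (iv) for `(Ψ⁻¹)^pf`", `O^▷(−)`, BACKWARD. PROVED. [cite: MochizukiEtTh2009, Cor 3.8 p.81] -/
theorem map_mem_endSubmonoid_perfectionMap_inverse
    (hΨ' : PreFrobenioid.IsFrobeniusCompatible C₂.toElem C₁.toElem h.Ψ.inverse) (hO : h.PreservesOTri)
    (X : (PreFrobenioidData.perfection hF₂).Pf) (ε : End X)
    (hε : ε ∈ (PreFrobenioidData.perfection hF₂).ops.endSubmonoid X) :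
    ((map (hF₁ := hF₂) (hF₂ := hF₁) hΨ').map ε : End ((map (hF₁ := hF₂) (hF₂ := hF₁) hΨ').obj X)) ∈
      (PreFrobenioidData.perfection hF₁).ops.endSubmonoid ((map (hF₁ := hF₂) (hF₂ := hF₁) hΨ').obj X) :=
  PerfectionMap.map_mem_endSubmonoid hΨ' hO.2 hε

/-- The identity functor of a perfection `1`-commutes with `Ψ ⋙ Ψ⁻¹ ≅ 𝟭` over `C → C^pf` (bookkeeping for the
uniqueness argument). [cite: MochizukiFrdI2008, Thm. 3.4 (iii) p.62] -/
theorem oneCommutes_id_of_iso {E : Type*} [Category E] {P : Type*} [Category P] (K : E ⥤ E) (L : E ⥤ P)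
    (i : K ≅ 𝟭 E) : OneCommutes K L L (𝟭 P) :=
  ⟨Functor.isoWhiskerRight i L ≪≫ L.leftUnitor ≪≫ L.rightUnitor.symm⟩

/-- **THE equivalence `Ψ^pf : C₁^pf ≌ C₂^pf` with `functor = (Ψ)^pf`, `inverse = (Ψ⁻¹)^pf` on the nose**, for a
Frobenius-compatible `Ψ` with Frobenius-compatible quasi-inverse: unit and counit come from the
structure-compatible `1`-uniqueness of [FrdI] Thm. 3.4 (iii) (abc-iut-L1-d1 `map_unique_of_isFrobeniusCompatible`)
applied to `(Ψ ⋙ Ψ⁻¹)^pf = Ψ^pf ⋙ (Ψ⁻¹)^pf` (abc-iut-L6-t6 `map_comp_eq'`) against the identity functor; `C₁`,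
`C₂` are of Frobenius-isotropic type (Thm. 3.7 (i)). Existence statement (the data is assembled in the proof).
[cite: MochizukiEtTh2009, Cor 3.8 p.81] -/
theorem exists_perfectionEquiv (hF₁ : PreFrobenioid.IsFrobenioid C₁.toElem)
    (hF₂ : PreFrobenioid.IsFrobenioid C₂.toElem)
    (hΨ : PreFrobenioid.IsFrobeniusCompatible C₁.toElem C₂.toElem h.Ψ.functor)
    (hΨ' : PreFrobenioid.IsFrobeniusCompatible C₂.toElem C₁.toElem h.Ψ.inverse) :
    ∃ Ψpf : (PreFrobenioidData.perfection hF₁).Pf ≌ (PreFrobenioidData.perfection hF₂).Pf,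
      Ψpf.functor = map (hF₁ := hF₁) (hF₂ := hF₂) hΨ ∧ Ψpf.inverse = map (hF₁ := hF₂) (hF₂ := hF₁) hΨ' ∧
        OneCommutes h.Ψ.functor (PreFrobenioidData.perfection hF₂).toPf (PreFrobenioidData.perfection hF₁).toPf
          Ψpf.functor := by
  -- unit: `𝟭 ≅ Ψ^pf ⋙ (Ψ⁻¹)^pf = (Ψ ⋙ Ψ⁻¹)^pf`, by uniqueness against `Ψ ⋙ Ψ⁻¹ ≅ 𝟭`
  obtain ⟨η⟩ := map_unique_of_isFrobeniusCompatible (hF₁ := hF₁) (hF₂ := hF₁)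
    (isFrobeniusCompatible_comp hΨ hΨ') (C₁.isOfType_isFrobeniusIsotropic hF₁) (𝟭 _) (fun _ _ _ hf => hf)
    (fun _ _ _ _ => rfl) (oneCommutes_id_of_iso _ _ h.Ψ.unitIso.symm)
  -- counit: `(Ψ⁻¹)^pf ⋙ Ψ^pf = (Ψ⁻¹ ⋙ Ψ)^pf ≅ 𝟭`
  obtain ⟨ε⟩ := map_unique_of_isFrobeniusCompatible (hF₁ := hF₂) (hF₂ := hF₂)
    (isFrobeniusCompatible_comp hΨ' hΨ) (C₂.isOfType_isFrobeniusIsotropic hF₂) (𝟭 _) (fun _ _ _ hf => hf)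
    (fun _ _ _ _ => rfl) (oneCommutes_id_of_iso _ _ h.Ψ.counitIso)
  refine ⟨CategoryTheory.Equivalence.mk (map hΨ) (map hΨ')
      (η ≪≫ eqToIso (map_comp_eq' (hF₁ := hF₁) (hF₂ := hF₂) (hF₃ := hF₁) hΨ hΨ'))
      ((eqToIso (map_comp_eq' (hF₁ := hF₂) (hF₂ := hF₁) (hF₃ := hF₂) hΨ' hΨ)).symm ≪≫ ε.symm),
    rfl, rfl, ?_⟩
  exact ⟨(toPfCompMapIso (hF₁ := hF₁) (hF₂ := hF₂) hΨ).symm⟩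

/-- **C38-L06 ⟸ C38-L02a + C38-L04 + C38-L05(C₁) + C38-L05(C₂)** — the transport row with ALL FOUR
`Ψ^pf`-level binders of the frozen `PreservesBsFldPreStepsOfCriterion` DISCHARGED (for `Ψ^pf := Perfection.map`,
given Frobenius-compatibility witnesses of `Ψ`, `Ψ⁻¹` — consequences of C38-L02a at the canonical vocabulary,
`Cor38Hyp.isFrobeniusCompatible_of_preservesPreSteps`): `Ψ` and `Ψ⁻¹` preserve the base-field-theoretic pre-steps.
PROVED. [cite: MochizukiEtTh2009, Cor 3.8 p.81] -/
theorem preservesBsFldPreSteps_of_C_rows (hF₁ : PreFrobenioid.IsFrobenioid C₁.toElem)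
    (hF₂ : PreFrobenioid.IsFrobenioid C₂.toElem)
    (hΨ : PreFrobenioid.IsFrobeniusCompatible C₁.toElem C₂.toElem h.Ψ.functor)
    (hΨ' : PreFrobenioid.IsFrobeniusCompatible C₂.toElem C₁.toElem h.Ψ.inverse)
    (hps : h.PreservesPreSteps) (hO : h.PreservesOTri)
    (h5₁ : C₁.BsFldPreStepLimitCriterion (PreFrobenioidData.perfection hF₁))
    (h5₂ : C₂.BsFldPreStepLimitCriterion (PreFrobenioidData.perfection hF₂)) :
    h.PreservesBsFldPreSteps := by
  obtain ⟨Ψpf, hfun, hinv, hcomm⟩ := h.exists_perfectionEquiv hF₁ hF₂ hΨ hΨ'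
  refine h.preservesBsFldPreSteps_of_criterion (PreFrobenioidData.perfection hF₁) (PreFrobenioidData.perfection hF₂)
    hps h5₁ h5₂ Ψpf hcomm ?_ ?_ ?_ ?_
  · rw [hfun]; exact h.isCoAngularPreStep_perfectionMap hΨ hps
  · rw [hinv]; exact h.isCoAngularPreStep_perfectionMap_inverse hΨ' hps
  · rw [hfun]; exact h.map_mem_endSubmonoid_perfectionMap hΨ hO
  · rw [hinv]; exact h.map_mem_endSubmonoid_perfectionMap_inverse hΨ' hO

end Cor38Hyp

end Rows

end Literature.AnabelianGeometry.EtaleTheta
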